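import Summits.HodgeConjecture.CorCM.IrreducibleOddWeightsAdditivityHellyCMFields
import Literature.NumberTheory.ComplexMultiplication.CMTypeRankPartition
import HarnessLib

/-!
# BLOCKS ARE MEMBERS (abstract slots): block additivity `rank(Σ) + |C| = Σ_c rank(Σ|_c) + 1` is decided on sets of at
# most `q + 1` blocks (`rank(Σ|_c) ≤ q + 1`), or `[G : A] + 1` blocks, or PAIRS of blocks for commuting actions — and a
# minimal block-non-additive set of blocks `C₀` has `|C₀| ≤ rank(Σ|_c)` for EVERY block `c ∈ C₀`

COR-CM (cell `pub-hodgecm2`, binder seat `b16` gen 61, count-neutral claim BLOCKS ARE MEMBERS, file H1 — abstract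
`G`-slots; theorems only, no definition, no named fact, no `sorry`).  NEW as stated, hence under `Summits/`.  HONEST
FRAMING: finite-dimensional linear algebra about Kubota–Dodson ranks of families of CM types, read on Hodge groups of
products of abelian varieties with complex multiplication (`rank(Σ) − 1 = dim Hg(∏_i A_i)`); `HC_CM` is neither used
nor asserted.  CM-field dress: the sequel `IrreducibleOddWeightsBlockHellyCMFields`.

THE MECHANISM.  A family `Φ_i ⊆ E_i` (`i ∈ I`) of CM types for a conjugation `ρ ∈ G`, partitioned along `κ : I ↠ C`,
REGROUPS into the family indexed by `C` whose member at `c` is the family type `Σ|_c` of the block `(Φ_i)_{κ i = c}` on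
the `G`-set `⊔_{κ i = c} E_i` (`Literature/…/CMTypeRankPartition`: `typeRank_sigmaType_fiber`, the regrouping does not
change the rank).  Hence EVERY member-level statement of the lane — gen 59's Helly numbers for additivity
(`IrreducibleOddWeightsAdditivityHelly`: degree form `q + 1`, index form `[G : A] + 1`, commuting form `2`) and the
bound on minimal non-additive families (`|T₀| ≤ rank Φ_i` for every member) — holds VERBATIM FOR BLOCKS, a block
counting as one member of rank `rank(Σ|_c)` (`= dim MT(X_c)`, `X_c = ∏_{κ i = c} A_i`).  What has to be supplied is the
transport of the sub-families of the regrouped family (`⊔_{c ∈ T} Σ|_c` versus `Σ|_{κ ∈ T}`) and of `dim U` (not only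
of the rank) along equivariant surjections of slots:

* §0 `finrank_antiSpan_preimage_eq_of_surjective` (`dim U(p⁻¹Φ) = dim U(Φ)` along an equivariant surjection `p`).
* §1 `finrank_antiSpan_sigmaType_fiber` (`dim U(⊔_c Σ|_c) = dim U(Σ)`), `typeRank_sigmaType_subtype_fiber_eq` /
  `finrank_antiSpan_sigmaType_subtype_fiber_eq` (a set of blocks of the regrouped family has the rank / the `dim U` of
  the corresponding sub-family), `typeRank_fiber_add_card_eq_iff_finrank_eq` (block additivity of a set of blocks `T` in
  rank form ⟺ in `dim U` form for the regrouped family).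
* §2 **`typeRank_sigmaType_add_card_eq_sum_fiber_iff_forall_card_le_of_typeRank_le`** — BLOCK HELLY, degree form: if
  `rank(Σ|_c) ≤ q + 1` for every block (`dim Hg(X_c) ≤ q`), then `rank(Σ) + |C| = Σ_c rank(Σ|_c) + 1`
  (`Hg(∏_i A_i) = ∏_c Hg(X_c)`) IFF `rank(Σ|_{κ ∈ T}) + |T| = Σ_{c ∈ T} rank(Σ|_c) + 1` for every non-empty set `T` of at
  most `q + 1` blocks; **`…_index_succ_of_smul_comm`** — index form (`A ≤ G` of finite index acting through pairwise
  commuting permutations: sets of at most `[G : A] + 1` blocks); **`…_two_of_smul_comm`** — PAIRS OF BLOCKS when all of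
  `G` acts through commuting permutations; **`card_le_typeRank_fiber_of_minimal`** — a minimal block-non-additive set of
  blocks `C₀` has `|C₀| ≤ rank(Σ|_c)` for EVERY `c ∈ C₀`; `exists_card_le_typeRank_sigmaType_add_card_ne_sum_fiber`,
  `exists_minimal_typeRank_fiber_add_card_ne`.

With `κ = id` every statement is its gen-59 member version; NOTHING is assumed inside a block.

## References

* [MoonenZarhin1999LowDim] B. Moonen, Yu. Zarhin, *Hodge classes on abelian varieties of low dimension*, Math. Ann.
  315 (1999), §3 (3.1), Remark (3.9).
* [Mai1989] L. Mai, *Lower bounds for the ranks of CM types*, J. Number Theory 32 (1989), §2 Prop. 1 (proof).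
* [Gordon1999HodgeAVSurvey] B. B. Gordon, *A survey of the Hodge conjecture for abelian varieties*, §3 Theorem (Imai,
  Murty) with proof; 7.5–7.7.
* [Serre1977] J.-P. Serre, *Linear Representations of Finite Groups*, GTM 42 (1977), §3.1 Cor. to Thm. 9.
* [Shimura1998] G. Shimura, *Abelian Varieties with Complex Multiplication and Modular Functions* (1998), §32.7,
  §32.10.
* [Deligne1982HodgeCycles] P. Deligne, *Hodge cycles on abelian varieties*, LNM 900 (1982), I Ex. 3.7.
-/

set_option autoImplicit false

noncomputable section

open scoped BigOperators

namespace Summit.HodgeConjecture.CorCM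

namespace IrrOdd

open Literature.NumberTheory.ComplexMultiplication

universe w u v

variable {G : Type w} [Group G]

/-! ### §0 `dim U` along an equivariant surjection of slots -/

section Transport

variable {X : Type*} {X' : Type*} [MulAction G X] [MulAction G X']

/-- Along an equivariant map `p : X' → X`, the `±1`-vector of a translate of `p⁻¹Φ` is the `±1`-vector of the translate
of `Φ` composed with `p`. [cite: Shimura1998, §32.7] -/
theorem antiVec_preimage_of_equivariant (Φ : Set X) (p : X' → X) (hp : ∀ (g : G) (x' : X'), p (g • x') = g • p x')
    (g : G) : antiVec (p ⁻¹' Φ) g = antiVec Φ g ∘ p := by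
  funext x'
  simp only [antiVec, Function.comp_apply, translateInd_preimage_of_equivariant Φ p hp g]

/-- **`dim U(p⁻¹Φ) = dim U(Φ)` along an equivariant SURJECTION `p : X' → X`** (precomposition with `p` is an injective
linear map `ℚ^X → ℚ^{X'}` carrying the `±1`-vectors of the translates of `Φ` to those of `p⁻¹Φ`; the rank version is the
tree's `typeRank_preimage_eq_of_surjective`). [cite: Shimura1998, §32.7 and §32.10] -/
theorem finrank_antiSpan_preimage_eq_of_surjective (Φ : Set X) (p : X' → X)
    (hp : ∀ (g : G) (x' : X'), p (g • x') = g • p x') (hsurj : Function.Surjective p) :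
    Module.finrank ℚ (antiSpan G (p ⁻¹' Φ)) = Module.finrank ℚ (antiSpan G Φ) := by
  have hrange : (Set.range fun g : G => antiVec (p ⁻¹' Φ) g) =
      (LinearMap.funLeft ℚ ℚ p) '' (Set.range fun g : G => antiVec Φ g) := by
    ext v
    simp only [Set.mem_range, Set.mem_image, exists_exists_eq_and]
    constructor
    · rintro ⟨g, rfl⟩
      exact ⟨g, by rw [antiVec_preimage_of_equivariant Φ p hp g]; rfl⟩
    · rintro ⟨g, rfl⟩
      exact ⟨g, by rw [antiVec_preimage_of_equivariant Φ p hp g]; rfl⟩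
  unfold antiSpan
  rw [hrange, ← Submodule.map_span]
  exact (LinearEquiv.finrank_eq (Submodule.equivMapOfInjective _
    (LinearMap.funLeft_injective_of_surjective ℚ ℚ p hsurj) _)).symm

end Transport

/-! ### §1 Sets of blocks of the regrouped family versus sub-families -/

section Regroup

variable {I : Type u} {E : I → Type v} [∀ i, MulAction G (E i)] {C : Type*}

/-- **`dim U` is unchanged by regrouping**: `dim U(⊔_c Σ|_c) = dim U(Σ)` (the `dim U` companion of the tree's
`typeRank_sigmaType_fiber`). [cite: Gordon1999HodgeAVSurvey, 7.7] [cite: Deligne1982HodgeCycles, I Ex. 3.7] -/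
theorem finrank_antiSpan_sigmaType_fiber (Φ : ∀ i, Set (E i)) (κ : I → C) :
    Module.finrank ℚ (antiSpan G (sigmaType fun c => sigmaType fun i : {i // κ i = c} => Φ i.1)) =
      Module.finrank ℚ (antiSpan G (sigmaType Φ)) := by
  rw [← preimage_regroup_sigmaType Φ κ]
  exact finrank_antiSpan_preimage_eq_of_surjective (G := G) (sigmaType Φ) _ (fun g x => by
    obtain ⟨c, ⟨i, hi⟩, s⟩ := x; rfl) fun y => ⟨⟨κ y.1, ⟨y.1, rfl⟩, y.2⟩, rfl⟩

/-- **A set of blocks of the regrouped family has the rank of the corresponding sub-family**: for `P` a set of blocks,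
`rank(⊔_{P c} Σ|_c) = rank(Σ|_{P ∘ κ})` (Kubota's rank along the equivariant bijection `(c, (i, s)) ↦ (i, s)` between
`⊔_{P c} ⊔_{κ i = c} E_i` and `⊔_{P (κ i)} E_i`). [cite: Gordon1999HodgeAVSurvey, 7.7] [cite: Deligne1982HodgeCycles, I Ex. 3.7] -/
theorem typeRank_sigmaType_subtype_fiber_eq (Φ : ∀ i, Set (E i)) (κ : I → C) (P : C → Prop) :
    typeRank G (sigmaType fun c : {c // P c} => sigmaType fun i : {i // κ i = c.1} => Φ i.1) =
      typeRank G (sigmaType fun i : {i // P (κ i)} => Φ i.1) := by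
  set q : (Σ c : {c // P c}, Σ i : {i // κ i = c.1}, E i.1) → Σ i : {i // P (κ i)}, E i.1 :=
    fun x => ⟨⟨x.2.1.1, by rw [x.2.1.2]; exact x.1.2⟩, x.2.2⟩ with hq
  have hq_smul : ∀ (g : G) (x : Σ c : {c // P c}, Σ i : {i // κ i = c.1}, E i.1), q (g • x) = g • q x := by
    rintro g ⟨⟨c, hc⟩, ⟨i, hi⟩, s⟩
    rfl
  have hq_surj : Function.Surjective q := by
    rintro ⟨⟨i, hi⟩, s⟩
    exact ⟨⟨⟨κ i, hi⟩, ⟨i, rfl⟩, s⟩, rfl⟩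
  have hq_pre : q ⁻¹' (sigmaType fun i : {i // P (κ i)} => Φ i.1) =
      sigmaType fun c : {c // P c} => sigmaType fun i : {i // κ i = c.1} => Φ i.1 := by
    ext x
    obtain ⟨⟨c, hc⟩, ⟨i, hi⟩, s⟩ := x
    rfl
  rw [← hq_pre]
  exact typeRank_preimage_eq_of_surjective (G := G) _ q hq_smul hq_surj

/-- `dim U` version of `typeRank_sigmaType_subtype_fiber_eq`: `dim U(⊔_{P c} Σ|_c) = dim U(Σ|_{P ∘ κ})`.
[cite: Gordon1999HodgeAVSurvey, 7.7] [cite: Deligne1982HodgeCycles, I Ex. 3.7] -/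
theorem finrank_antiSpan_sigmaType_subtype_fiber_eq (Φ : ∀ i, Set (E i)) (κ : I → C) (P : C → Prop) :
    Module.finrank ℚ (antiSpan G (sigmaType fun c : {c // P c} => sigmaType fun i : {i // κ i = c.1} => Φ i.1)) =
      Module.finrank ℚ (antiSpan G (sigmaType fun i : {i // P (κ i)} => Φ i.1)) := by
  set q : (Σ c : {c // P c}, Σ i : {i // κ i = c.1}, E i.1) → Σ i : {i // P (κ i)}, E i.1 :=
    fun x => ⟨⟨x.2.1.1, by rw [x.2.1.2]; exact x.1.2⟩, x.2.2⟩ with hq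
  have hq_smul : ∀ (g : G) (x : Σ c : {c // P c}, Σ i : {i // κ i = c.1}, E i.1), q (g • x) = g • q x := by
    rintro g ⟨⟨c, hc⟩, ⟨i, hi⟩, s⟩
    rfl
  have hq_surj : Function.Surjective q := by
    rintro ⟨⟨i, hi⟩, s⟩
    exact ⟨⟨⟨κ i, hi⟩, ⟨i, rfl⟩, s⟩, rfl⟩
  have hq_pre : q ⁻¹' (sigmaType fun i : {i // P (κ i)} => Φ i.1) =
      sigmaType fun c : {c // P c} => sigmaType fun i : {i // κ i = c.1} => Φ i.1 := by
    ext x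
    obtain ⟨⟨c, hc⟩, ⟨i, hi⟩, s⟩ := x
    rfl
  rw [← hq_pre]
  exact finrank_antiSpan_preimage_eq_of_surjective (G := G) _ q hq_smul hq_surj

/-- The Finset form of `finrank_antiSpan_sigmaType_subtype_fiber_eq` (sets of blocks `T : Finset C`, as consumed by the
member-level Helly theorems): `dim U(⊔_{c ∈ T} Σ|_c) = dim U(Σ|_{κ ∈ T})`. [cite: Gordon1999HodgeAVSurvey, 7.7] -/
theorem finrank_antiSpan_sigmaType_coe_fiber_eq (Φ : ∀ i, Set (E i)) (κ : I → C) (T : Finset C) :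
    Module.finrank ℚ (antiSpan G (sigmaType fun c : (T : Set C) =>
        sigmaType fun i : {i // κ i = (c : C)} => Φ i.1)) =
      Module.finrank ℚ (antiSpan G (sigmaType fun i : {i // κ i ∈ T} => Φ i.1)) :=
  finrank_antiSpan_sigmaType_subtype_fiber_eq (G := G) Φ κ fun c => c ∈ T

variable [Fintype I] [∀ i, Fintype (E i)] [∀ i, Nonempty (E i)] [Fintype C] [DecidableEq C]

omit [Fintype C] in
/-- **Block additivity of a set of blocks, rank form ⟺ `dim U` form for the regrouped family.**  For a non-empty set of
blocks `T` of a partition `κ : I ↠ C` of CM types for `ρ`: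
`rank(Σ|_{κ ∈ T}) + |T| = Σ_{c ∈ T} rank(Σ|_c) + 1` (`Hg(∏_{c ∈ T} X_c) = ∏_{c ∈ T} Hg(X_c)`) iff
`dim U(⊔_{c ∈ T} Σ|_c) = Σ_{c ∈ T} dim U(Σ|_c)`. [cite: Shimura1998, §32.10 Prop.] [cite: Gordon1999HodgeAVSurvey, 7.7] -/
theorem typeRank_fiber_add_card_eq_iff_finrank_eq {ρ : G} {Φ : ∀ i, Set (E i)} (h : ∀ i, IsCMTypeWith ρ (Φ i))
    (κ : I → C) (hκ : Function.Surjective κ) (T : Finset C) (hT : T.Nonempty) :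
    typeRank G (sigmaType fun i : {i // κ i ∈ T} => Φ i.1) + T.card =
        (∑ c ∈ T, typeRank G (sigmaType fun i : {i // κ i = c} => Φ i.1)) + 1 ↔
      Module.finrank ℚ (antiSpan G (sigmaType fun c : (T : Set C) =>
          sigmaType fun i : {i // κ i = (c : C)} => Φ i.1)) =
        ∑ c : (T : Set C), Module.finrank ℚ (antiSpan G (sigmaType fun i : {i // κ i = (c : C)} => Φ i.1)) := by
  obtain ⟨c₁, hc₁⟩ := hT
  haveI : Nonempty (T : Set C) := ⟨⟨c₁, hc₁⟩⟩
  haveI : ∀ c : C, Nonempty (Σ i : {i // κ i = c}, E i.1) := fun c => by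
    obtain ⟨i, hi⟩ := hκ c
    exact ⟨⟨⟨i, hi⟩, Classical.arbitrary (E i)⟩⟩
  have key := typeRank_sigmaType_add_card_eq_iff_finrank_eq (G := G)
    (E := fun c : (T : Set C) => Σ i : {i // κ i = (c : C)}, E i.1)
    (Φ := fun c : (T : Set C) => sigmaType fun i : {i // κ i = (c : C)} => Φ i.1)
    fun c => isCMTypeWith_sigmaType_fiber h κ (c : C)
  have hrank : typeRank G (sigmaType fun c : (T : Set C) => sigmaType fun i : {i // κ i = (c : C)} => Φ i.1) =
      typeRank G (sigmaType fun i : {i // κ i ∈ T} => Φ i.1) :=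
    typeRank_sigmaType_subtype_fiber_eq (G := G) Φ κ fun c => c ∈ T
  have hcard : Fintype.card (T : Set C) = T.card := Fintype.card_coe T
  have hsum : ∑ c : (T : Set C), typeRank G (sigmaType fun i : {i // κ i = (c : C)} => Φ i.1) =
      ∑ c ∈ T, typeRank G (sigmaType fun i : {i // κ i = c} => Φ i.1) :=
    Finset.sum_coe_sort T fun c => typeRank G (sigmaType fun i : {i // κ i = c} => Φ i.1)
  rw [hrank, hcard, hsum] at key
  exact key

omit [Fintype I] [∀ i, Fintype (E i)] [∀ i, Nonempty (E i)] [Fintype C] [DecidableEq C] in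
/-- The empty set of blocks is block additive in `dim U` form (`U(∅) = 0`). [folklore] -/
theorem finrank_antiSpan_sigmaType_coe_empty_fiber_eq_sum (Φ : ∀ i, Set (E i)) (κ : I → C) :
    Module.finrank ℚ (antiSpan G (sigmaType fun c : ((∅ : Finset C) : Set C) =>
        sigmaType fun i : {i // κ i = (c : C)} => Φ i.1)) =
      ∑ c : ((∅ : Finset C) : Set C),
        Module.finrank ℚ (antiSpan G (sigmaType fun i : {i // κ i = (c : C)} => Φ i.1)) :=
  finrank_antiSpan_sigmaType_coe_empty_eq_sum (G := G) (E := fun c : C => Σ i : {i // κ i = c}, E i.1)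
    fun c => sigmaType fun i : {i // κ i = c} => Φ i.1

end Regroup

/-! ### §2 Block Helly numbers and minimal block-non-additive sets of blocks (abstract slots) -/

section Helly

variable {I : Type u} {E : I → Type v} [∀ i, MulAction G (E i)] [Fintype I] [∀ i, Fintype (E i)]
  [∀ i, Nonempty (E i)] {C : Type*} [Fintype C] [DecidableEq C]

/-- **BLOCK HELLY, DEGREE FORM: `Hg(∏_i A_i) = ∏_c Hg(X_c)` IS DECIDED ON SETS OF AT MOST `q + 1` BLOCKS,
`q ≥ max_c dim Hg(X_c)`.**  `G` permutes finite slots `E_i`, `Φ_i` CM types for `ρ`, `κ : I ↠ C` a partition with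
`rank(Σ|_c) ≤ q + 1` for every block.  Then `rank(Σ) + |C| = Σ_c rank(Σ|_c) + 1` IFF for every non-empty set `T` of at
most `q + 1` blocks `rank(Σ|_{κ ∈ T}) + |T| = Σ_{c ∈ T} rank(Σ|_c) + 1`.  NOTHING is assumed inside the blocks; no
representation is listed (the member-level theorem for the regrouped family). [cite: Mai1989, §2 Prop. 1 (proof)]
[cite: MoonenZarhin1999LowDim, §3 (3.1)] [cite: Gordon1999HodgeAVSurvey, 7.7] -/
theorem typeRank_sigmaType_add_card_eq_sum_fiber_iff_forall_card_le_of_typeRank_le [Nonempty I] {ρ : G}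
    {Φ : ∀ i, Set (E i)} (h : ∀ i, IsCMTypeWith ρ (Φ i)) (κ : I → C) (hκ : Function.Surjective κ) (q : ℕ)
    (hq : ∀ c, typeRank G (sigmaType fun i : {i // κ i = c} => Φ i.1) ≤ q + 1) :
    typeRank G (sigmaType Φ) + Fintype.card C = (∑ c, typeRank G (sigmaType fun i : {i // κ i = c} => Φ i.1)) + 1 ↔
      ∀ T : Finset C, T.Nonempty → T.card ≤ q + 1 →
        typeRank G (sigmaType fun i : {i // κ i ∈ T} => Φ i.1) + T.card =
          (∑ c ∈ T, typeRank G (sigmaType fun i : {i // κ i = c} => Φ i.1)) + 1 := by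
  haveI : Nonempty C := ⟨κ (Classical.arbitrary I)⟩
  haveI : ∀ c : C, Nonempty (Σ i : {i // κ i = c}, E i.1) := fun c => by
    obtain ⟨i, hi⟩ := hκ c
    exact ⟨⟨⟨i, hi⟩, Classical.arbitrary (E i)⟩⟩
  have key := typeRank_sigmaType_add_card_eq_iff_forall_card_le_of_typeRank_le (G := G)
    (E := fun c : C => Σ i : {i // κ i = c}, E i.1) (Φ := fun c => sigmaType fun i : {i // κ i = c} => Φ i.1)
    (fun c => isCMTypeWith_sigmaType_fiber h κ c) q hq
  rw [typeRank_sigmaType_fiber] at key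
  rw [key]
  refine forall_congr' fun T => forall_congr' fun hT => forall_congr' fun _ => ?_
  exact (typeRank_fiber_add_card_eq_iff_finrank_eq h κ hκ T hT).symm

/-- **A block-non-additive partition has a block-non-additive set of at most `q + 1` blocks** (`rank(Σ|_c) ≤ q + 1`
for all `c`): `Hg(∏_i A_i) ⊊ ∏_c Hg(X_c)` is witnessed on the product of at most `q + 1` of the `X_c`.
[cite: Mai1989, §2 Prop. 1 (proof)] [cite: MoonenZarhin1999LowDim, §3 (3.1)] -/
theorem exists_card_le_typeRank_sigmaType_add_card_ne_sum_fiber [Nonempty I] {ρ : G} {Φ : ∀ i, Set (E i)}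
    (h : ∀ i, IsCMTypeWith ρ (Φ i)) (κ : I → C) (hκ : Function.Surjective κ) (q : ℕ)
    (hq : ∀ c, typeRank G (sigmaType fun i : {i // κ i = c} => Φ i.1) ≤ q + 1)
    (hnot : typeRank G (sigmaType Φ) + Fintype.card C ≠
      (∑ c, typeRank G (sigmaType fun i : {i // κ i = c} => Φ i.1)) + 1) :
    ∃ T : Finset C, T.Nonempty ∧ T.card ≤ q + 1 ∧
      typeRank G (sigmaType fun i : {i // κ i ∈ T} => Φ i.1) + T.card ≠
        (∑ c ∈ T, typeRank G (sigmaType fun i : {i // κ i = c} => Φ i.1)) + 1 := by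
  by_contra hall
  push Not at hall
  exact hnot ((typeRank_sigmaType_add_card_eq_sum_fiber_iff_forall_card_le_of_typeRank_le h κ hκ q hq).2
    fun T hT hTc => hall T hT hTc)

/-- **BLOCK HELLY, INDEX FORM: sets of at most `[G : A] + 1` blocks decide**, for `A ≤ G` of finite index whose elements
act on every slot through pairwise commuting permutations (e.g. `A` abelian); nothing assumed inside the blocks.
[cite: Serre1977, §3.1 Cor. to Thm. 9] [cite: Mai1989, §2 Prop. 1 (proof)] [cite: MoonenZarhin1999LowDim, §3 (3.1)] -/
theorem typeRank_sigmaType_add_card_eq_sum_fiber_iff_forall_card_le_index_succ_of_smul_comm [Nonempty I] {ρ : G}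
    {Φ : ∀ i, Set (E i)} (h : ∀ i, IsCMTypeWith ρ (Φ i)) (κ : I → C) (hκ : Function.Surjective κ)
    (A : Subgroup G) [A.FiniteIndex] (hA : ∀ a ∈ A, ∀ b ∈ A, ∀ (i : I) (s : E i), a • b • s = b • a • s) :
    typeRank G (sigmaType Φ) + Fintype.card C = (∑ c, typeRank G (sigmaType fun i : {i // κ i = c} => Φ i.1)) + 1 ↔
      ∀ T : Finset C, T.Nonempty → T.card ≤ A.index + 1 →
        typeRank G (sigmaType fun i : {i // κ i ∈ T} => Φ i.1) + T.card =
          (∑ c ∈ T, typeRank G (sigmaType fun i : {i // κ i = c} => Φ i.1)) + 1 := by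
  haveI : Nonempty C := ⟨κ (Classical.arbitrary I)⟩
  haveI : ∀ c : C, Nonempty (Σ i : {i // κ i = c}, E i.1) := fun c => by
    obtain ⟨i, hi⟩ := hκ c
    exact ⟨⟨⟨i, hi⟩, Classical.arbitrary (E i)⟩⟩
  have hA' : ∀ a ∈ A, ∀ b ∈ A, ∀ (c : C) (x : Σ i : {i // κ i = c}, E i.1), a • b • x = b • a • x := by
    intro a ha b hb c x
    obtain ⟨⟨i, hi⟩, s⟩ := x
    change (⟨⟨i, hi⟩, a • b • s⟩ : Σ i : {i // κ i = c}, E i.1) = ⟨⟨i, hi⟩, b • a • s⟩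
    rw [hA a ha b hb i s]
  have key := finrank_antiSpan_sigmaType_eq_sum_iff_forall_card_le_index_succ_of_smul_comm (G := G)
    (E := fun c : C => Σ i : {i // κ i = c}, E i.1) (fun c => sigmaType fun i : {i // κ i = c} => Φ i.1) A hA'
  rw [← typeRank_sigmaType_add_card_eq_iff_finrank_eq
    (Φ := fun c => sigmaType fun i : {i // κ i = c} => Φ i.1) (fun c => isCMTypeWith_sigmaType_fiber h κ c),
    typeRank_sigmaType_fiber] at key
  rw [key]
  refine ⟨fun H T hT hTc => (typeRank_fiber_add_card_eq_iff_finrank_eq h κ hκ T hT).2 (H T hTc), fun H T hTc => ?_⟩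
  by_cases hT : T.Nonempty
  · exact (typeRank_fiber_add_card_eq_iff_finrank_eq h κ hκ T hT).1 (H T hT hTc)
  · rw [Finset.not_nonempty_iff_eq_empty.1 hT]
    exact finrank_antiSpan_sigmaType_coe_empty_fiber_eq_sum (G := G) Φ κ

/-- **BLOCK HELLY, ABELIAN FORM: PAIRS OF BLOCKS DECIDE** when all of `G` acts through pairwise commuting permutations —
`Hg(∏_c X_c) = ∏_c Hg(X_c)` iff `Hg(X_c × X_{c'}) = Hg(X_c) × Hg(X_{c'})` for all pairs of blocks (for TORI there is no
Goursat–Ribet lemma in general; commuting actions are exactly the case where pairs suffice).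
[cite: Serre1977, §3.1 Thm. 9] [cite: MoonenZarhin1999LowDim, §3 (3.1) and Remark (3.9)] -/
theorem typeRank_sigmaType_add_card_eq_sum_fiber_iff_forall_card_le_two_of_smul_comm [Nonempty I] {ρ : G}
    {Φ : ∀ i, Set (E i)} (h : ∀ i, IsCMTypeWith ρ (Φ i)) (κ : I → C) (hκ : Function.Surjective κ)
    (hG : ∀ (a b : G) (i : I) (s : E i), a • b • s = b • a • s) :
    typeRank G (sigmaType Φ) + Fintype.card C = (∑ c, typeRank G (sigmaType fun i : {i // κ i = c} => Φ i.1)) + 1 ↔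
      ∀ T : Finset C, T.Nonempty → T.card ≤ 2 →
        typeRank G (sigmaType fun i : {i // κ i ∈ T} => Φ i.1) + T.card =
          (∑ c ∈ T, typeRank G (sigmaType fun i : {i // κ i = c} => Φ i.1)) + 1 := by
  have key := typeRank_sigmaType_add_card_eq_sum_fiber_iff_forall_card_le_index_succ_of_smul_comm h κ hκ
    (⊤ : Subgroup G) fun a _ b _ i s => hG a b i s
  rwa [Subgroup.index_top] at key

/-- **MINIMAL BLOCK-NON-ADDITIVE SETS OF BLOCKS: `|C₀| ≤ rank(Σ|_c)` FOR EVERY BLOCK `c ∈ C₀`** — if the blocks in `C₀`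
fail `Hg(∏_{c ∈ C₀} X_c) = ∏_{c ∈ C₀} Hg(X_c)` while every non-empty proper set of blocks of `C₀` satisfies it, then
`|C₀| ≤ rank(Σ|_c) = dim MT(X_c)` for every `c ∈ C₀`: a block with a small Hodge group takes part in no large minimal
interaction, whatever happens inside the blocks. [cite: Mai1989, §2 Prop. 1 (proof)] [cite: MoonenZarhin1999LowDim, §3 (3.1)]
[cite: Shimura1998, §32.10 Prop.] -/
theorem card_le_typeRank_fiber_of_minimal {ρ : G} {Φ : ∀ i, Set (E i)} (h : ∀ i, IsCMTypeWith ρ (Φ i))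
    (κ : I → C) (hκ : Function.Surjective κ) (C₀ : Finset C)
    (hnot : typeRank G (sigmaType fun i : {i // κ i ∈ C₀} => Φ i.1) + C₀.card ≠
      (∑ c ∈ C₀, typeRank G (sigmaType fun i : {i // κ i = c} => Φ i.1)) + 1)
    (hmin : ∀ T : Finset C, T ⊂ C₀ → T.Nonempty →
      typeRank G (sigmaType fun i : {i // κ i ∈ T} => Φ i.1) + T.card =
        (∑ c ∈ T, typeRank G (sigmaType fun i : {i // κ i = c} => Φ i.1)) + 1)
    {c : C} (hc : c ∈ C₀) : C₀.card ≤ typeRank G (sigmaType fun i : {i // κ i = c} => Φ i.1) := by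
  haveI : ∀ c : C, Nonempty (Σ i : {i // κ i = c}, E i.1) := fun c => by
    obtain ⟨i, hi⟩ := hκ c
    exact ⟨⟨⟨i, hi⟩, Classical.arbitrary (E i)⟩⟩
  have hC₀ : C₀.Nonempty := ⟨c, hc⟩
  refine card_le_typeRank_of_minimal_nonadditive (G := G) (E := fun c : C => Σ i : {i // κ i = c}, E i.1)
    (Φ := fun c => sigmaType fun i : {i // κ i = c} => Φ i.1) (fun c => isCMTypeWith_sigmaType_fiber h κ c) C₀
    (fun H => hnot ((typeRank_fiber_add_card_eq_iff_finrank_eq h κ hκ C₀ hC₀).2 H)) (fun T hT => ?_) hc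
  by_cases hTne : T.Nonempty
  · exact (typeRank_fiber_add_card_eq_iff_finrank_eq h κ hκ T hTne).1 (hmin T hT hTne)
  · rw [Finset.not_nonempty_iff_eq_empty.1 hTne]
    exact finrank_antiSpan_sigmaType_coe_empty_fiber_eq_sum (G := G) Φ κ

/-- **A block-non-additive partition contains a MINIMAL block-non-additive set of blocks**, and it is small:
`|C₀| ≤ rank(Σ|_c)` for every `c ∈ C₀`. [cite: MoonenZarhin1999LowDim, §3 (3.1)] [cite: Mai1989, §2 Prop. 1 (proof)] -/
theorem exists_minimal_typeRank_fiber_add_card_ne [Nonempty I] {ρ : G} {Φ : ∀ i, Set (E i)}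
    (h : ∀ i, IsCMTypeWith ρ (Φ i)) (κ : I → C) (hκ : Function.Surjective κ)
    (hnot : typeRank G (sigmaType Φ) + Fintype.card C ≠
      (∑ c, typeRank G (sigmaType fun i : {i // κ i = c} => Φ i.1)) + 1) :
    ∃ C₀ : Finset C, C₀.Nonempty ∧
      typeRank G (sigmaType fun i : {i // κ i ∈ C₀} => Φ i.1) + C₀.card ≠
        (∑ c ∈ C₀, typeRank G (sigmaType fun i : {i // κ i = c} => Φ i.1)) + 1 ∧
      (∀ T : Finset C, T ⊂ C₀ → T.Nonempty →
        typeRank G (sigmaType fun i : {i // κ i ∈ T} => Φ i.1) + T.card =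
          (∑ c ∈ T, typeRank G (sigmaType fun i : {i // κ i = c} => Φ i.1)) + 1) ∧
      ∀ c ∈ C₀, C₀.card ≤ typeRank G (sigmaType fun i : {i // κ i = c} => Φ i.1) := by
  classical
  let badd : Finset C → Prop := fun T =>
    typeRank G (sigmaType fun i : {i // κ i ∈ T} => Φ i.1) + T.card =
      (∑ c ∈ T, typeRank G (sigmaType fun i : {i // κ i = c} => Φ i.1)) + 1
  -- the whole partition is a block-non-additive set of blocks
  have huniv : ¬ badd Finset.univ := by
    intro H
    apply hnot
    have hrank : typeRank G (sigmaType fun i : {i // κ i ∈ (Finset.univ : Finset C)} => Φ i.1) =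
        typeRank G (sigmaType Φ) := by
      rw [← typeRank_sigmaType_subtype_fiber_eq (G := G) Φ κ fun c => c ∈ (Finset.univ : Finset C),
        ← typeRank_sigmaType_fiber (G := G) Φ κ]
      set e : (Σ c : {c // c ∈ (Finset.univ : Finset C)}, Σ i : {i // κ i = c.1}, E i.1) →
          Σ c : C, Σ i : {i // κ i = c}, E i.1 := fun x => ⟨x.1.1, x.2⟩ with he
      have he_smul : ∀ (g : G) (x : Σ c : {c // c ∈ (Finset.univ : Finset C)}, Σ i : {i // κ i = c.1}, E i.1),
          e (g • x) = g • e x := by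
        rintro g ⟨⟨c, hc⟩, ⟨i, hi⟩, s⟩
        rfl
      have he_surj : Function.Surjective e := fun y => ⟨⟨⟨y.1, Finset.mem_univ _⟩, y.2⟩, rfl⟩
      have he_pre : e ⁻¹' (sigmaType fun c : C => sigmaType fun i : {i // κ i = c} => Φ i.1) =
          sigmaType fun c : {c // c ∈ (Finset.univ : Finset C)} =>
            sigmaType fun i : {i // κ i = c.1} => Φ i.1 := by
        ext x
        obtain ⟨⟨c, hc⟩, ⟨i, hi⟩, s⟩ := x
        rfl
      rw [← he_pre]
      exact typeRank_preimage_eq_of_surjective (G := G) _ e he_smul he_surj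
    have H' : typeRank G (sigmaType fun i : {i // κ i ∈ (Finset.univ : Finset C)} => Φ i.1) +
        (Finset.univ : Finset C).card =
        (∑ c ∈ (Finset.univ : Finset C), typeRank G (sigmaType fun i : {i // κ i = c} => Φ i.1)) + 1 := H
    rw [hrank, Finset.card_univ] at H'
    exact H'
  -- a block-non-additive set of blocks of least cardinality
  have hex : ∃ m, ∃ T : Finset C, T.Nonempty ∧ T.card = m ∧ ¬ badd T :=
    ⟨_, Finset.univ, ⟨κ (Classical.arbitrary I), Finset.mem_univ _⟩, rfl, huniv⟩
  obtain ⟨C₀, hC₀ne, hC₀card, hC₀⟩ := Nat.find_spec hex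
  have hmin : ∀ T : Finset C, T ⊂ C₀ → T.Nonempty → badd T := by
    intro T hT hTne
    by_contra hT'
    have hlt : T.card < C₀.card := Finset.card_lt_card hT
    have hle : Nat.find hex ≤ T.card := Nat.find_min' hex ⟨T, hTne, rfl, hT'⟩
    omega
  exact ⟨C₀, hC₀ne, hC₀, hmin, fun c hc => card_le_typeRank_fiber_of_minimal h κ hκ C₀ hC₀ hmin hc⟩

end Helly

end IrrOdd

end Summit.HodgeConjecture.CorCM

end
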